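import Mathlib
import HarnessLib
import Summits.Ventures.LatticeQCDFlow.Scaling.AutoregressiveGaugeMixingTimeWindow
import Summits.Ventures.LatticeQCDFlow.Scaling.AutoregressiveGaugeColdEscapeDimension

/-!
# LatticeQCDFlow / Scaling — the worst-case mixing time of the optimal one-plaquette heat bath by dimension:
# volume-independent in `d = 2`, exponential in the volume in `d ≥ 3`

HONEST FRAMING: exact (Metropolis-corrected) sampling algorithms for lattice gauge theory;
figures of merit are autocorrelation/cost numbers at stated couplings and volumes; no
continuum-physics claim.

Venture `LatticeQCDFlow` (cell pub-lqcd), topic `Scaling`, FANOUT row 30 (lean-1, GEN-28) — OUR WORK on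
THEORY-2.md §4 row C5, combining the mixing-time window (`AutoregressiveGaugeMixingTimeWindow`: `ε`-mixed once
`t·A(cold) ≥ log(1/ε)`, not `ε`-mixed while `t·A(cold) < 1 − ε`) with the dimension dependence of the exact cold
acceptance mass of the heat bath along an OPTIMAL ranked structure of `(ℤ/L)^d`
(`AutoregressiveGaugeColdEscapeDimension`: `A(cold) ≥ m/M` in `d = 2`; `A(cold) ≤ θ₁^s` with
`(2(d−1) − 1)·s ≥ k_min(d, L) = (d−1)(d−2)/2·L^d + (d−1)` in every `d`, `θ₁ = c₂/(cM)`):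

* **`two_dim_optimal_heatBath_mixed_of_log_le`** — `d = 2`, optimal structure (`#Bᶜ = 1`), `w(1) = M`: if
  `t·(m/M) ≥ log(1/ε)` (`ε > 0`) then at time `t` every start and every event are `ε`-close to `π` — a mixing
  time `≤ (M/m)·log(1/ε) + 1`, UNIFORMLY IN `L`;
* **`optimal_heatBath_not_mixed_of_mul_lt`** — every `d ≥ 1`, atom-free Haar, optimal structure: there is `s`
  with `(2(d−1) − 1)·s ≥ k_min(d, L)` such that whenever `t·θ₁^s < 1 − ε`, at time `t` NOT every start and event
  are `ε`-close to `π` — a worst-case mixing time `≥ (1 − ε)·θ₁^{−s}`;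
* **`three_dim_optimal_heatBath_not_mixed_of_mul_lt`** — `d = 3`: the same with `3s ≥ L³ + 2`, i.e. a
  worst-case `ε`-mixing time `≥ (1 − ε)·(cM/c₂)^{(L³+2)/3}` (for non-constant `w`, `c₂ < cM`): EXPONENTIAL IN
  THE VOLUME, for every coupling.

NOT CLAIMED: the size of `Z`; mixing from a particular warm start; any value of `c₂/(cM)` for a specific weight.
No `def`, no `sorry`, nothing cited as a fact beyond the tree.
-/

noncomputable section

namespace Summit.Ventures.LatticeQCDFlow.Theory2.Autoregressive

open MeasureTheory ProbabilityTheory Function Finset Summit.Ventures.LatticeQCDFlow.Exactness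
open Literature.MathematicalPhysics.QuantumFieldTheory Literature.MathematicalPhysics.QuantumLattice
open scoped ENNReal

variable {d L : ℕ} [NeZero L] {G : Type*} [Group G] [TopologicalSpace G] [IsTopologicalGroup G]
  [CompactSpace G] [SecondCountableTopology G] [MeasurableSpace G] [BorelSpace G]

/-- **TWO DIMENSIONS: MIXED AFTER `(M/m)·log(1/ε)` STEPS, UNIFORMLY IN `L`.**  Optimal ranked structure of
`(ℤ/L)^2` (`#Bᶜ = 1`), `0 < m ≤ w ≤ M = w(1)`: if `t·(m/M) ≥ log(1/ε)` (`ε > 0`), then at time `t` every start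
and every event of the exact heat bath are `ε`-close to `π`. [ours] -/
theorem two_dim_optimal_heatBath_mixed_of_log_le (hL : 2 ≤ L) {w : G → ℝ} (hw : Continuous w) {m M : ℝ}
    (hm0 : 0 < m) (hm : ∀ g, m ≤ w g) (hM : ∀ g, w g ≤ M) (hw1 : w 1 = M)
    (B : Finset (Plaquette 2 L)) (t : Plaquette 2 L → Edge 2 L)
    (ht : ∀ p ∈ B, t p ∈ ({(p.1, p.2.1.1), (p.1.shift p.2.1.1, p.2.1.2),
        (p.1.shift p.2.1.2, p.2.1.1), (p.1, p.2.1.2)} : Finset (Edge 2 L)))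
    (rank : Plaquette 2 L → ℕ)
    (hrank : ∀ p ∈ B, ∀ p' ∈ B, p ≠ p' → t p ∈ ({(p'.1, p'.2.1.1), (p'.1.shift p'.2.1.1, p'.2.1.2),
        (p'.1.shift p'.2.1.2, p'.2.1.1), (p'.1, p'.2.1.2)} : Finset (Edge 2 L)) → rank p < rank p')
    (hopt : (Finset.univ \ B).card = 1)
    (π q : Measure (GaugeConfig 2 L G)) [IsProbabilityMeasure π] [IsProbabilityMeasure q]
    (hπ : π = (Measure.pi fun _ : Edge 2 L => haarProbability G).withDensity fun U =>
      ENNReal.ofReal ((∏ p : Plaquette 2 L, w (plaquetteHolonomy U p.1 p.2.1.1 p.2.1.2)) /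
        ∫ V, ∏ p : Plaquette 2 L, w (plaquetteHolonomy V p.1 p.2.1.1 p.2.1.2)
          ∂(Measure.pi fun _ : Edge 2 L => haarProbability G)))
    (hq : q = (Measure.pi fun _ : Edge 2 L => haarProbability G).withDensity fun U =>
      ENNReal.ofReal ((∏ p ∈ B, w (plaquetteHolonomy U p.1 p.2.1.1 p.2.1.2)) /
        ∫ V, ∏ p ∈ B, w (plaquetteHolonomy V p.1 p.2.1.1 p.2.1.2)
          ∂(Measure.pi fun _ : Edge 2 L => haarProbability G)))
    {ε : ℝ} (hε : 0 < ε) {n : ℕ} (hn : Real.log (1 / ε) ≤ n * (m / M))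
    (μ : Measure (GaugeConfig 2 L G)) [IsProbabilityMeasure μ] (A : Set (GaugeConfig 2 L G)) :
    |((fun ν : Measure (GaugeConfig 2 L G) => ν.bind (indepMH q fun U =>
        ((∫ V, ∏ p : Plaquette 2 L, w (plaquetteHolonomy V p.1 p.2.1.1 p.2.1.2)
            ∂(Measure.pi fun _ : Edge 2 L => haarProbability G)) /
          ((∫ V, ∏ p ∈ B, w (plaquetteHolonomy V p.1 p.2.1.1 p.2.1.2)
            ∂(Measure.pi fun _ : Edge 2 L => haarProbability G)) *
            ∏ p ∈ Finset.univ \ B, w (plaquetteHolonomy U p.1 p.2.1.1 p.2.1.2)))⁻¹))^[n] μ).real A -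
        π.real A| ≤ ε := by
  have hw0 : ∀ g, 0 < w g := fun g => hm0.trans_le (hm g)
  have hMpos : 0 < M := (hw0 1).trans_le (hM 1)
  have hmM : m / M ≤ 1 := div_le_one_of_le₀ ((hm 1).trans (hM 1)) hMpos.le
  exact (two_dim_heatBath_uniform_rate hL hw hm0 hm hM hw1 B t ht rank hrank hopt π q hπ hq μ n A).trans
    (one_sub_pow_le_of_log_le hε hmM hn)

/-- **EVERY DIMENSION: NOT MIXED BEFORE `(1 − ε)·θ₁^{−s}` STEPS, `(2(d−1) − 1)·s ≥ k_min(d, L)`.**  Atom-free Haar,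
`d ≥ 1`, optimal ranked structure of `(ℤ/L)^d` (`#Bᶜ = k_min(d, L)`), `0 < m ≤ w ≤ M = w(1)`: there is `s` with
`(2(d−1) − 1)·s ≥ k_min(d, L)` such that whenever `t·θ₁^s < 1 − ε` (`θ₁ = c₂/(cM)`), at time `t` NOT every start
and event of the exact heat bath are `ε`-close to `π`. [ours] -/
theorem optimal_heatBath_not_mixed_of_mul_lt [MeasurableSingletonClass G] [NullSingletonClass (haarProbability G)]
    (hd : 0 < d) (hL : 2 ≤ L) {w : G → ℝ} (hw : Continuous w) {m M : ℝ} (hm0 : 0 < m)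
    (hm : ∀ g, m ≤ w g) (hM : ∀ g, w g ≤ M) (hw1 : w 1 = M)
    (B : Finset (Plaquette d L)) (t : Plaquette d L → Edge d L)
    (ht : ∀ p ∈ B, t p ∈ ({(p.1, p.2.1.1), (p.1.shift p.2.1.1, p.2.1.2),
        (p.1.shift p.2.1.2, p.2.1.1), (p.1, p.2.1.2)} : Finset (Edge d L)))
    (rank : Plaquette d L → ℕ)
    (hrank : ∀ p ∈ B, ∀ p' ∈ B, p ≠ p' → t p ∈ ({(p'.1, p'.2.1.1), (p'.1.shift p'.2.1.1, p'.2.1.2),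
        (p'.1.shift p'.2.1.2, p'.2.1.1), (p'.1, p'.2.1.2)} : Finset (Edge d L)) → rank p < rank p')
    (hopt : (Finset.univ \ B).card = (d - 1) * (d - 2) / 2 * L ^ d + (d - 1))
    (π q : Measure (GaugeConfig d L G)) [IsProbabilityMeasure π] [IsProbabilityMeasure q]
    (hπ : π = (Measure.pi fun _ : Edge d L => haarProbability G).withDensity fun U =>
      ENNReal.ofReal ((∏ p : Plaquette d L, w (plaquetteHolonomy U p.1 p.2.1.1 p.2.1.2)) /
        ∫ V, ∏ p : Plaquette d L, w (plaquetteHolonomy V p.1 p.2.1.1 p.2.1.2)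
          ∂(Measure.pi fun _ : Edge d L => haarProbability G)))
    (hq : q = (Measure.pi fun _ : Edge d L => haarProbability G).withDensity fun U =>
      ENNReal.ofReal ((∏ p ∈ B, w (plaquetteHolonomy U p.1 p.2.1.1 p.2.1.2)) /
        ∫ V, ∏ p ∈ B, w (plaquetteHolonomy V p.1 p.2.1.1 p.2.1.2)
          ∂(Measure.pi fun _ : Edge d L => haarProbability G))) :
    ∃ s : ℕ, (d - 1) * (d - 2) / 2 * L ^ d + (d - 1) ≤ (2 * (d - 1) - 1) * s ∧
      ∀ (ε : ℝ) (n : ℕ), n * ((∫ h, w h ^ 2 ∂(haarProbability G)) / ((∫ g, w g ∂(haarProbability G)) * M)) ^ s <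
          1 - ε →
        ¬ ∀ (μ : Measure (GaugeConfig d L G)) [IsProbabilityMeasure μ] (A : Set (GaugeConfig d L G)),
          |((fun ν : Measure (GaugeConfig d L G) => ν.bind (indepMH q fun U =>
            ((∫ V, ∏ p : Plaquette d L, w (plaquetteHolonomy V p.1 p.2.1.1 p.2.1.2)
                ∂(Measure.pi fun _ : Edge d L => haarProbability G)) /
              ((∫ V, ∏ p ∈ B, w (plaquetteHolonomy V p.1 p.2.1.1 p.2.1.2)
                ∂(Measure.pi fun _ : Edge d L => haarProbability G)) *
                ∏ p ∈ Finset.univ \ B, w (plaquetteHolonomy U p.1 p.2.1.1 p.2.1.2)))⁻¹))^[n] μ).real A -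
            π.real A| ≤ ε := by
  obtain ⟨s, hk, hle⟩ := optimal_heatBath_coldRate_le_pow hL hw hm0 hm hM B t ht rank hrank hopt
  refine ⟨s, hk, fun ε n hn => heatBath_not_mixed_of_mul_lt hd hL hw hm0 hm hM hw1 B t ht rank hrank π q hπ hq
    ((mul_le_mul_of_nonneg_left hle (Nat.cast_nonneg n)).trans_lt hn)⟩

/-- **THREE DIMENSIONS: NOT MIXED BEFORE `(1 − ε)·θ₁^{−s}` STEPS WITH `3s ≥ L³ + 2`** — the worst-case `ε`-mixing
time of the exact heat bath on an optimal ranked structure of `(ℤ/L)^3` (`#Bᶜ = L³ + 2`) is at least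
`(1 − ε)·(cM/c₂)^{(L³+2)/3}`: exponential in the volume whenever `c₂ < cM` (non-constant `w`). [ours] -/
theorem three_dim_optimal_heatBath_not_mixed_of_mul_lt [MeasurableSingletonClass G]
    [NullSingletonClass (haarProbability G)] (hL : 2 ≤ L) {w : G → ℝ} (hw : Continuous w) {m M : ℝ} (hm0 : 0 < m)
    (hm : ∀ g, m ≤ w g) (hM : ∀ g, w g ≤ M) (hw1 : w 1 = M)
    (B : Finset (Plaquette 3 L)) (t : Plaquette 3 L → Edge 3 L)
    (ht : ∀ p ∈ B, t p ∈ ({(p.1, p.2.1.1), (p.1.shift p.2.1.1, p.2.1.2),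
        (p.1.shift p.2.1.2, p.2.1.1), (p.1, p.2.1.2)} : Finset (Edge 3 L)))
    (rank : Plaquette 3 L → ℕ)
    (hrank : ∀ p ∈ B, ∀ p' ∈ B, p ≠ p' → t p ∈ ({(p'.1, p'.2.1.1), (p'.1.shift p'.2.1.1, p'.2.1.2),
        (p'.1.shift p'.2.1.2, p'.2.1.1), (p'.1, p'.2.1.2)} : Finset (Edge 3 L)) → rank p < rank p')
    (hopt : (Finset.univ \ B).card = L ^ 3 + 2)
    (π q : Measure (GaugeConfig 3 L G)) [IsProbabilityMeasure π] [IsProbabilityMeasure q]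
    (hπ : π = (Measure.pi fun _ : Edge 3 L => haarProbability G).withDensity fun U =>
      ENNReal.ofReal ((∏ p : Plaquette 3 L, w (plaquetteHolonomy U p.1 p.2.1.1 p.2.1.2)) /
        ∫ V, ∏ p : Plaquette 3 L, w (plaquetteHolonomy V p.1 p.2.1.1 p.2.1.2)
          ∂(Measure.pi fun _ : Edge 3 L => haarProbability G)))
    (hq : q = (Measure.pi fun _ : Edge 3 L => haarProbability G).withDensity fun U =>
      ENNReal.ofReal ((∏ p ∈ B, w (plaquetteHolonomy U p.1 p.2.1.1 p.2.1.2)) /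
        ∫ V, ∏ p ∈ B, w (plaquetteHolonomy V p.1 p.2.1.1 p.2.1.2)
          ∂(Measure.pi fun _ : Edge 3 L => haarProbability G))) :
    ∃ s : ℕ, L ^ 3 + 2 ≤ 3 * s ∧
      ∀ (ε : ℝ) (n : ℕ), n * ((∫ h, w h ^ 2 ∂(haarProbability G)) / ((∫ g, w g ∂(haarProbability G)) * M)) ^ s <
          1 - ε →
        ¬ ∀ (μ : Measure (GaugeConfig 3 L G)) [IsProbabilityMeasure μ] (A : Set (GaugeConfig 3 L G)),
          |((fun ν : Measure (GaugeConfig 3 L G) => ν.bind (indepMH q fun U =>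
            ((∫ V, ∏ p : Plaquette 3 L, w (plaquetteHolonomy V p.1 p.2.1.1 p.2.1.2)
                ∂(Measure.pi fun _ : Edge 3 L => haarProbability G)) /
              ((∫ V, ∏ p ∈ B, w (plaquetteHolonomy V p.1 p.2.1.1 p.2.1.2)
                ∂(Measure.pi fun _ : Edge 3 L => haarProbability G)) *
                ∏ p ∈ Finset.univ \ B, w (plaquetteHolonomy U p.1 p.2.1.1 p.2.1.2)))⁻¹))^[n] μ).real A -
            π.real A| ≤ ε := by
  have hopt' : (Finset.univ \ B).card = (3 - 1) * (3 - 2) / 2 * L ^ 3 + (3 - 1) := by rw [hopt]; norm_num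
  obtain ⟨s, hk, h⟩ := optimal_heatBath_not_mixed_of_mul_lt (by norm_num : 0 < 3) hL hw hm0 hm hM hw1 B t ht rank
    hrank hopt' π q hπ hq
  exact ⟨s, by norm_num at hk; omega, h⟩

end Summit.Ventures.LatticeQCDFlow.Theory2.Autoregressive

end
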